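import Summits.CriticalPhenomena.PercolationContinuityZ3.Theorems.PercNearOneGluingNoHeavyLowerTailIncStarWDOMTwoProngedCore
import HarnessLib

/-!
# Merging parallel coins behind a sure pair (Sahi programme, prover prim-sahi-p2 gen 36)

Support file (`--supports stmt-CriticalPhenomena-4575`); no definitions, no named facts, no sorries; standard axioms.  Memo
`run/shared/lean/prim/prim-sahi/FROM-prim-sahi-p2-gen36-ALL-OR-NOTHING.md` §6(2b), `prim-sahi-p2/PROOF-E3.md` §46.

If the pair `s–x` is SURE (`w(s,x) = 1`), the two coins `s–y` and `x–y` act as parallel edges between the blob `{s,x}` and `y`: for every event depending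
only on the CLUSTER of `s`, the law is unchanged when `x–y` is deleted and `s–y` is given the merged weight `1 − (1 − w(s,y))(1 − w(x,y))`:
**`real_clusterMem_mergeParallel`**.  This is the contraction-free form of "contract the sure pair `s–x`" needed to put relay-cloud statements
(TOP*, memo §0(2)) under the two-pronged lemmas (`wdom_twoPronged`, `twoPronged_transport`, `allOrNothing_root`).
Proof: two-pair pinning of the parallel coins (`real_twoBondDecomp`); on the sure sets the three laws with at least one of the two coins open agree on
cluster events (`openCluster_insert_of_mem`: inserting a pair whose endpoints are already joined to `s` does not change `C_s`); one-pair decomposition of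
the merged weight (`stub_oneBondDecomp_k15`).
-/

noncomputable section

namespace Summit.CriticalPhenomena.PercolationContinuityZ3.Theorems

namespace IncStar

open MeasureTheory Set Literature.Probability.Percolation Literature.Probability.LatticeModels EdgeInduction
open scoped Classical

variable {n : ℕ}

/-- Inserting a pair whose two endpoints are already joined to `s` does not change the cluster of `s`. [folklore] -/
theorem openCluster_insert_of_mem {ω : BondConfig (Fin n)} {s a b : Fin n}
    (ha : (openGraph ω).Reachable s a) (hb : (openGraph ω).Reachable s b) :
    openCluster (insert s(a, b) ω) s = openCluster ω s := by
  ext z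
  simp only [openCluster, Set.mem_setOf_eq]
  constructor
  · intro h
    have key : ∀ z : Fin n, Relation.ReflTransGen (openGraph (insert s(a, b) ω)).Adj s z → (openGraph ω).Reachable s z := by
      intro z hz
      induction hz with
      | refl => exact SimpleGraph.Reachable.refl _
      | @tail c d _ hcd ih =>
        rw [openGraph_adj, Set.mem_insert_iff] at hcd
        obtain ⟨hcd | hcd, hne⟩ := hcd
        · rw [Sym2.eq_iff] at hcd
          rcases hcd with ⟨_, hd⟩ | ⟨_, hd⟩
          · subst hd; exact hb
          · subst hd; exact ha
        · have hadj : (openGraph ω).Adj c d := by rw [openGraph_adj]; exact ⟨hcd, hne⟩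
          exact ih.trans hadj.reachable
    rw [SimpleGraph.reachable_iff_reflTransGen] at h
    exact key z h
  · intro h
    exact h.mono (openGraph_mono (Set.subset_insert _ _))

/-- **Merging parallel coins behind a sure pair.**  `s, x, y` distinct, `w(s,x) = 1`, `e₁ = s(s,y)`, `e₂ = s(x,y)`, and `w′ = w[e₂ ↦ 0][e₁ ↦ A]` with
`A = 1 − (1 − w e₁)(1 − w e₂)`.  Then `P_w{C_s ∈ 𝒜} = P_{w′}{C_s ∈ 𝒜}` for every family `𝒜` of vertex sets. [this work] -/
theorem real_clusterMem_mergeParallel (w w' : Sym2 (Fin n) → unitInterval) {s x y : Fin n} (hxs : x ≠ s) (hys : y ≠ s) (hyx : y ≠ x)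
    (hsure : w s(s, x) = 1) (A : unitInterval) (hA : (A : ℝ) = 1 - (1 - (w s(s, y) : ℝ)) * (1 - (w s(x, y) : ℝ)))
    (hw' : w' = Function.update (Function.update w s(x, y) 0) s(s, y) A) (𝒜 : Set (Set (Fin n))) :
    (prodBernoulli w).real {ω | openCluster ω s ∈ 𝒜} = (prodBernoulli w').real {ω | openCluster ω s ∈ 𝒜} := by
  set e₁ : Sym2 (Fin n) := s(s, y) with he₁
  set e₂ : Sym2 (Fin n) := s(x, y) with he₂
  have hne : e₁ ≠ e₂ := by
    rw [he₁, he₂]; intro h; rw [Sym2.eq_iff] at h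
    rcases h with ⟨h, _⟩ | ⟨h, _⟩; exacts [hxs h.symm, hys h.symm]
  have hsx₁ : s(s, x) ≠ e₁ := by
    rw [he₁]; intro h; rw [Sym2.eq_iff] at h
    rcases h with ⟨_, h⟩ | ⟨h, _⟩; exacts [hyx h.symm, hys h.symm]
  have hsx₂ : s(s, x) ≠ e₂ := by
    rw [he₂]; intro h; rw [Sym2.eq_iff] at h
    rcases h with ⟨h, _⟩ | ⟨h, _⟩; exacts [hxs h.symm, hys h.symm]
  set X : Set (BondConfig (Fin n)) := {ω | openCluster ω s ∈ 𝒜} with hX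
  set p : ℝ := (w e₁ : ℝ) with hp
  set r : ℝ := (w e₂ : ℝ) with hr
  -- the pinned laws and their sure sets
  haveI : ∀ a b : unitInterval, IsProbabilityMeasure (pin₂ w e₁ e₂ a b) := fun a b => by unfold pin₂; infer_instance
  have wval := pin₂_update_apply w hne
  have sure : ∀ (a b : unitInterval), (pin₂ w e₁ e₂ a b).real
      ({ω | ∀ f, Function.update (Function.update w e₁ a) e₂ b f = 1 → f ∈ ω} ∩
        {ω | ∀ f, Function.update (Function.update w e₁ a) e₂ b f = 0 → f ∉ ω}) = 1 := fun a b => real_sureSet _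
  have sx_mem : ∀ (a b : unitInterval) (ω : BondConfig (Fin n)),
      ω ∈ ({ω | ∀ f, Function.update (Function.update w e₁ a) e₂ b f = 1 → f ∈ ω} ∩
        {ω | ∀ f, Function.update (Function.update w e₁ a) e₂ b f = 0 → f ∉ ω} : Set (BondConfig (Fin n))) → s(s, x) ∈ ω :=
    fun a b ω hω => hω.1 _ (by rw [wval, if_neg hsx₂, if_neg hsx₁]; exact hsure)
  have e₁_mem : ∀ (b : unitInterval) (ω : BondConfig (Fin n)),
      ω ∈ ({ω | ∀ f, Function.update (Function.update w e₁ 1) e₂ b f = 1 → f ∈ ω} ∩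
        {ω | ∀ f, Function.update (Function.update w e₁ 1) e₂ b f = 0 → f ∉ ω} : Set (BondConfig (Fin n))) → e₁ ∈ ω :=
    fun b ω hω => hω.1 e₁ (by rw [wval, if_neg hne, if_pos rfl])
  have e₂_mem : ∀ (a : unitInterval) (ω : BondConfig (Fin n)),
      ω ∈ ({ω | ∀ f, Function.update (Function.update w e₁ a) e₂ 1 f = 1 → f ∈ ω} ∩
        {ω | ∀ f, Function.update (Function.update w e₁ a) e₂ 1 f = 0 → f ∉ ω} : Set (BondConfig (Fin n))) → e₂ ∈ ω :=
    fun a ω hω => hω.1 e₂ (by rw [wval, if_pos rfl])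
  have reach_x : ∀ ω : BondConfig (Fin n), s(s, x) ∈ ω → (openGraph ω).Reachable s x := by
    intro ω h; have hadj : (openGraph ω).Adj s x := by rw [openGraph_adj]; exact ⟨h, hxs.symm⟩
    exact hadj.reachable
  have reach_y₁ : ∀ ω : BondConfig (Fin n), e₁ ∈ ω → (openGraph ω).Reachable s y := by
    intro ω h; have hadj : (openGraph ω).Adj s y := by rw [openGraph_adj]; exact ⟨h, hys.symm⟩
    exact hadj.reachable
  have reach_y₂ : ∀ ω : BondConfig (Fin n), s(s, x) ∈ ω → e₂ ∈ ω → (openGraph ω).Reachable s y := by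
    intro ω h1 h2
    have hadj : (openGraph ω).Adj x y := by rw [openGraph_adj]; exact ⟨h2, hyx.symm⟩
    exact (reach_x ω h1).trans hadj.reachable
  -- P¹¹ = P¹⁰ and P¹¹ = P⁰¹ on cluster events
  have h11_10 : (pin₂ w e₁ e₂ 1 1).real X = (pin₂ w e₁ e₂ 1 0).real X := by
    rw [pin₂_real_one_one_eq_one_zero w e₁ e₂ X]
    refine real_congr_on_sure (sure 1 0) fun ω hω => ?_
    simp only [Set.mem_preimage, hX, Set.mem_setOf_eq]
    rw [openCluster_insert_of_mem (reach_x ω (sx_mem 1 0 ω hω)) (reach_y₁ ω (e₁_mem 0 ω hω))]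
  have h11_01 : (pin₂ w e₁ e₂ 1 1).real X = (pin₂ w e₁ e₂ 0 1).real X := by
    rw [pin₂_real_one_one_eq_zero_one w hne X]
    refine real_congr_on_sure (sure 0 1) fun ω hω => ?_
    simp only [Set.mem_preimage, hX, Set.mem_setOf_eq]
    rw [openCluster_insert_of_mem (SimpleGraph.Reachable.refl _) (reach_y₂ ω (sx_mem 0 1 ω hω) (e₂_mem 0 ω hω))]
  -- left side
  have hL := real_twoBondDecomp w hne X
  -- right side: one-pair decomposition of `w'` at `e₁`
  have hR := stub_oneBondDecomp_k15 n w' e₁ X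
  have hw'e₁ : (w' e₁ : ℝ) = (A : ℝ) := by rw [hw']; simp
  have hw'0 : Function.update w' e₁ 0 = Function.update (Function.update w e₁ 0) e₂ 0 := by
    rw [hw', Function.update_idem, Function.update_comm hne.symm]
  have hw'1 : Function.update w' e₁ 1 = Function.update (Function.update w e₁ 1) e₂ 0 := by
    rw [hw', Function.update_idem, Function.update_comm hne.symm]
  rw [hR, hw'e₁, hw'0, hw'1, hA, hL, h11_01.symm.trans h11_10, h11_10]
  simp only [pin₂]
  ring

end IncStar

end Summit.CriticalPhenomena.PercolationContinuityZ3.Theorems
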